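import Summits.Ventures.Crystal3D.Theorems.StickyWulffConstantTextureLiminfTexShadowLevelReachAbs
import Summits.Ventures.Crystal3D.Theorems.StickyWulffConstantCoaxialWallLawPayerFamilyEndsPlates
import HarnessLib

/-!
# The END PAIRS of one word family LAUNCHED INSIDE THE WINDOW, relaunches counted (level reach, geometric layer)
# (lane T, crux `TextureLiminfV5`, stmt-Ventures-23912, registered stub `stub_terraceCensus`; (β) terrace census, LevelReach — count half)

HONEST FRAMING. Venture `Summits/Ventures/Crystal3D` (cell `crystal3d-full`), route `route-Ventures-StickyWulffConstant`, helper `--supports`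
the law-v5 crux `TextureLiminfV5` (stmt-Ventures-23912), lane T, mechanism (β) (level ledger; resume records HOME/wall-p1-g19/BETA-LEDGER-RESUME-g19.md
§4(2), HOME/wall-p1-g20/BETA-LITE-g20.md rev 4.1 §9).  Census-free, certificate-free; inputs `KissingGap δ`, `KissingClassification δ` BY NAME
exactly as in lane F's family census; nothing about energies is asserted; F-C1 not moved.

THE POINT.  Lane F's `word_family_endPairs_plates` (…CoaxialWallLawPayerFamilyEndsPlates) VERBATIM — same word data `F, u, WF, next`, same state
invariant `P`, same CORE `P'` (rigidity `hstd`, bottom sealing), same top plate `P₂` (sealing, top exclusion `hPexcl0`), same typed END PAIRS `T`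
with the same four exported properties — with ONE change: the SOURCES are the balls of an arbitrary finite LAUNCH SET `L` inside the window, each
a legal moving root state (`hLsrc`) with `p + F [] (u []) ∉ L` (`hLstep`), instead of the admissible balls of the core below the window.  A launch
inside the window can be stepped onto by the walk of another launch; such RELAUNCHES are COUNTED, in the precise form the move map allows: the
arriving state sits at the root-line predecessor `p − F [] (u [])`, carries the invariant, lies in the window, and either moves STRAIGHT in the root
class `[]`, or CROSSES from a one-letter class `[μ]` along a reading normal `m` popping it back to the root class (`next [μ] m = []`, a cancelling
pair).  **`word_family_endPairs_launch`**: `#{p ∈ L : first step inside the window} ≤ #T + #{relaunched p ∈ L} + 220·#rim_top + 220·#rim_bottom`.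
For the (β) ledger (BETA-LEDGER-RESUME-g19 §4(2) «`#S ≤ #T_k + #Reach_k + rim`»): a launched line ENDS, is RELAUNCHED INTO (merge), or leaves
through a rim; arrivals at the top plate are what `hPexcl0` excludes — for word-related plates a theorem (…TexShadowWordThreading, …WordNoEntry,
…WordNoEntryBarlow); the core hypotheses are lane F's Barlow discharges unchanged; abstract layer `word_sources_le_exact_launch_cell` (…LevelReachAbs).
WHAT THIS IS NOT: any bound on the relaunch term, the multi-root pooling, the launch-set supply count, any certificate / energy statement; F-C1 not moved.
-/

noncomputable section

namespace Summit.Ventures.Crystal3D.Theorems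

open Summit.Ventures.Crystal3D Finset
open Literature.MathematicalPhysics.StatisticalMechanics (fccStacking)
open scoped InnerProductSpace

section Instance

variable {X : Finset (EuclideanSpace ℝ (Fin 3))}
  {F : List (EuclideanSpace ℝ (Fin 3)) → (EuclideanSpace ℝ (Fin 3) ≃ₗᵢ[ℝ] EuclideanSpace ℝ (Fin 3))}
  {u : List (EuclideanSpace ℝ (Fin 3)) → EuclideanSpace ℝ (Fin 3)}
  {WF : List (EuclideanSpace ℝ (Fin 3)) → Prop}
  {next : List (EuclideanSpace ℝ (Fin 3)) → EuclideanSpace ℝ (Fin 3) → List (EuclideanSpace ℝ (Fin 3))}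
  {P' P₂ : Finset (EuclideanSpace ℝ (Fin 3))} {R₀ h ρ : ℝ}

open scoped Classical in
/-- **The end pairs of one word family at version `ver`, launched from a set `L` inside the window, relaunches counted.**  Hypotheses
VERBATIM from `word_family_endPairs_plates` except that the LAUNCH SET `L` (`hLsrc`, `hLstep`) replaces the core sources; the second term on the
right counts the launch balls `p` whose root-line predecessor `p − F [] (u [])` is an invariant window state arriving at `p` in the root class,
straight (first disjunct) or by a cancelling-pair cross from a class `[μ]` (second disjunct).  See the module docstring. -/
theorem word_family_endPairs_launch (ver : WordVersion) {δ : ℝ} (hg : KissingGap δ) (hc : KissingClassification δ)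
    (hX : ∀ p ∈ X, ∀ q ∈ X, p ≠ q → 1 ≤ dist p q)
    (hFc : ∀ μ κ, F (μ :: κ) = ((ℝ ∙ μ)ᗮ.reflection).trans (F κ))
    (hu : ∀ κ, u κ ∈ fccSlots) (huc : ∀ μ κ, u (μ :: κ) = -u κ)
    (hWF0 : WF [])
    (hWFc : ∀ μ κ, WF (μ :: κ) ↔ (WF κ ∧ ‖μ‖ = 1 ∧
      (∀ w ∈ fccSlots, ⟪w, μ⟫_ℝ = 0 ∨ ⟪w, μ⟫_ℝ = Real.sqrt (2 / 3) ∨ ⟪w, μ⟫_ℝ = -Real.sqrt (2 / 3)) ∧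
      ⟪u κ, μ⟫_ℝ = Real.sqrt (2 / 3) ∧ ∀ μ' κ', κ = μ' :: κ' → μ' ≠ -μ))
    (hnext_pop : ∀ μ κ' (m : EuclideanSpace ℝ (Fin 3)), (F (μ :: κ')).symm m = -μ → next (μ :: κ') m = κ')
    (hnext_push : ∀ κ (m : EuclideanSpace ℝ (Fin 3)), (∀ μ κ', κ = μ :: κ' → (F κ).symm m ≠ -μ) →
      next κ m = (F κ).symm m :: κ)
    -- the state invariant (preserved by LEGAL moves) and the top exclusion
    {P : EuclideanSpace ℝ (Fin 3) × List (EuclideanSpace ℝ (Fin 3)) → Prop}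
    (hPstraight : ∀ (b : EuclideanSpace ℝ (Fin 3)) (κ : List (EuclideanSpace ℝ (Fin 3))), WF κ →
      (IsFull X (F κ) b ∨ (∃ m, IsTwinReading X (F κ) m b ∧ ⟪F κ (u κ), m⟫_ℝ = 0) ∨
        (ver = WordVersion.v2 ∧ IsNarrow X (F κ) (F κ (u κ)) b)) →
      P (b, κ) → P (b + F κ (u κ), κ))
    (hPcross : ∀ (b : EuclideanSpace ℝ (Fin 3)) (κ : List (EuclideanSpace ℝ (Fin 3))) (m : EuclideanSpace ℝ (Fin 3)),
      WF κ → WF (next κ m) → IsTwinReading X (F κ) m b → ⟪F κ (u κ), m⟫_ℝ = Real.sqrt (2 / 3) →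
      P (b, κ) → P (b + F (next κ m) (u (next κ m)), next κ m))
    (hPexcl0 : ∀ (b : EuclideanSpace ℝ (Fin 3)) (κ : List (EuclideanSpace ℝ (Fin 3))), WF κ → P (b, κ) → b ∈ P₂ →
      (∃ a ∈ fccSlots, ∃ a' ∈ fccSlots, ∃ a'' ∈ fccSlots,
        ⟪a, a'⟫_ℝ = 1 / 2 ∧ ⟪a, a''⟫_ℝ = 1 / 2 ∧ ⟪a', a''⟫_ℝ = 1 / 2 ∧
        b + F κ a ∈ X ∧ b + F κ a' ∈ X ∧ b + F κ a'' ∈ X) → False)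
    (hup : 0 < (F [] (u [])) 2)
    -- the cell
    (hR₀ : 3 ≤ R₀) (hρ : R₀ ≤ ρ)
    -- the LAUNCH SET: legal moving root states, first step off the launch set, invariant started at the first step
    (L : Finset (EuclideanSpace ℝ (Fin 3)))
    (hLsrc : ∀ p ∈ L, p ∈ X ∧
      (∃ a ∈ fccSlots, ∃ a' ∈ fccSlots, ∃ a'' ∈ fccSlots,
        ⟪a, a'⟫_ℝ = 1 / 2 ∧ ⟪a, a''⟫_ℝ = 1 / 2 ∧ ⟪a', a''⟫_ℝ = 1 / 2 ∧
        p + F [] a ∈ X ∧ p + F [] a' ∈ X ∧ p + F [] a'' ∈ X) ∧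
      p - F [] (u []) ∈ X ∧
      (IsFull X (F []) p ∨ (∃ m, IsTwinReading X (F []) m p ∧ ⟪F [] (u []), m⟫_ℝ = 0) ∨
        (ver = WordVersion.v2 ∧ IsNarrow X (F []) (F [] (u [])) p)) ∧
      P (p + F [] (u []), []))
    (hLstep : ∀ p ∈ L, p + F [] (u []) ∉ L)
    -- the bottom plate's CORE: below the window, rigid, sealed
    (hP'top : ∀ p ∈ P', p 2 ≤ -R₀ - 1)
    (hstd : ∀ κ, WF κ → ∀ p ∈ P', (∃ a ∈ fccSlots, ∃ a' ∈ fccSlots, ∃ a'' ∈ fccSlots,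
        ⟪a, a'⟫_ℝ = 1 / 2 ∧ ⟪a, a''⟫_ℝ = 1 / 2 ∧ ⟪a', a''⟫_ℝ = 1 / 2 ∧
        p + F κ a ∈ X ∧ p + F κ a' ∈ X ∧ p + F κ a'' ∈ X) → F κ (u κ) = F [] (u []))
    (hsealB : ∀ s ∈ X, s ∉ P' → -R₀ - 1 - 1 ≤ s 2 → s 2 < -R₀ - 1 → s 0 ^ 2 + s 1 ^ 2 ≤ (ρ - 1) ^ 2 → False)
    (hP₂seal : ∀ s ∈ X, h + R₀ + 1 ≤ s 2 → s 2 ≤ h + R₀ + 1 + 1 → s 0 ^ 2 + s 1 ^ 2 ≤ (ρ - 2) ^ 2 → s ∈ P₂) :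
    ∃ T : Finset (EuclideanSpace ℝ (Fin 3) × EuclideanSpace ℝ (Fin 3)),
      (L.filter fun p => -R₀ - 1 < (p + F [] (u [])) 2 ∧ (p + F [] (u [])) 2 < h + R₀ + 1).card ≤
        T.card +
        (L.filter fun p => P (p - F [] (u []), []) ∧
            -R₀ - 1 ≤ (p - F [] (u [])) 2 ∧ (p - F [] (u [])) 2 < h + R₀ + 1 ∧
            (IsFull X (F []) (p - F [] (u [])) ∨
              (∃ m, IsTwinReading X (F []) m (p - F [] (u [])) ∧ ⟪F [] (u []), m⟫_ℝ = 0) ∨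
              (ver = WordVersion.v2 ∧ IsNarrow X (F []) (F [] (u [])) (p - F [] (u [])))) ∨
          ∃ μ, WF [μ] ∧ P (p - F [] (u []), [μ]) ∧
            -R₀ - 1 ≤ (p - F [] (u [])) 2 ∧ (p - F [] (u [])) 2 < h + R₀ + 1 ∧
            ∃ m, IsTwinReading X (F [μ]) m (p - F [] (u [])) ∧
              ⟪F [μ] (u [μ]), m⟫_ℝ = Real.sqrt (2 / 3) ∧ next [μ] m = []).card +
        220 * (X.filter fun s => h + R₀ + 1 ≤ s 2 ∧ s 2 ≤ h + R₀ + 1 + 1 ∧ (ρ - 2) ^ 2 < s 0 ^ 2 + s 1 ^ 2).card +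
        220 * (X.filter fun s => -R₀ - 1 - 1 ≤ s 2 ∧ s 2 < -R₀ - 1 ∧ (ρ - 1) ^ 2 < s 0 ^ 2 + s 1 ^ 2).card ∧
      (∀ bq ∈ T, bq.1 ∈ X ∧ bq.2 ∈ X ∧ dist bq.1 bq.2 = 1 ∧ -R₀ - 1 ≤ bq.1 2 ∧ bq.1 2 < h + R₀ + 1) ∧
      (∀ bq ∈ T, (X.filter fun q => dist bq.1 q = 1).card ≤ 11 ∨
        ∃ z₁ ∈ X, ∃ z₂ ∈ X, z₁ ≠ z₂ ∧ dist bq.1 z₁ = 1 ∧ dist bq.1 z₂ = 1 ∧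
          (X.filter fun q => dist z₁ q = 1).card ≤ 11 ∧ (X.filter fun q => dist z₂ q = 1).card ≤ 11) ∧
      (∀ bq ∈ T, ∃ κ, WF κ ∧ P (bq.1, κ)) ∧
      (∀ bq ∈ T, ∃ κ, WF κ ∧ bq.2 - F κ (u κ) ∈ X ∧ IsEndMove X ver (F κ) (F κ (u κ)) bq.2 bq.1) := by
  have hr : 0 < Real.sqrt (2 / 3) := Real.sqrt_pos.2 (by norm_num)
  -- the class data on the subtype of well-formed words
  set F' : {κ : List (EuclideanSpace ℝ (Fin 3)) // WF κ} →
      (EuclideanSpace ℝ (Fin 3) ≃ₗᵢ[ℝ] EuclideanSpace ℝ (Fin 3)) := fun κ => F κ.1 with hF'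
  set d' : {κ : List (EuclideanSpace ℝ (Fin 3)) // WF κ} → EuclideanSpace ℝ (Fin 3) :=
    fun κ => F κ.1 (u κ.1) with hd'
  set next' : {κ : List (EuclideanSpace ℝ (Fin 3)) // WF κ} → EuclideanSpace ℝ (Fin 3) →
      {κ : List (EuclideanSpace ℝ (Fin 3)) // WF κ} := fun κ m =>
    @dite _ (WF (next κ.1 m)) (Classical.propDecidable _) (fun hw => ⟨next κ.1 m, hw⟩) (fun _ => κ) with hnext'
  set root : {κ : List (EuclideanSpace ℝ (Fin 3)) // WF κ} := ⟨[], hWF0⟩ with hroot_def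
  -- the class change along a crossing normal
  have hspec : ∀ (κ : {κ : List (EuclideanSpace ℝ (Fin 3)) // WF κ}) (m : EuclideanSpace ℝ (Fin 3)), ‖m‖ = 1 →
      (∀ w ∈ fccSlots, ⟪F' κ w, m⟫_ℝ = 0 ∨ ⟪F' κ w, m⟫_ℝ = Real.sqrt (2 / 3) ∨ ⟪F' κ w, m⟫_ℝ = -Real.sqrt (2 / 3)) →
      ⟪d' κ, m⟫_ℝ = Real.sqrt (2 / 3) →
      (next' κ m).1 = next κ.1 m ∧ (∀ x, F (next κ.1 m) x = F κ.1 x - (2 * ⟪F κ.1 x, m⟫_ℝ) • m) ∧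
        ⟪F (next κ.1 m) (u (next κ.1 m)), m⟫_ℝ = Real.sqrt (2 / 3) ∧ next (next κ.1 m) m = κ.1 := by
    intro κ m hm hmenu hdm
    obtain ⟨hwf, hfr, hdir, hinv⟩ := word_next_spec hFc huc hWFc hnext_pop hnext_push κ.2 hm hmenu hdm
    exact ⟨by simp only [hnext']; rw [dif_pos hwf], hfr, hdir, hinv⟩
  have hmirror : ∀ (κ : {κ : List (EuclideanSpace ℝ (Fin 3)) // WF κ}) (m : EuclideanSpace ℝ (Fin 3)), ‖m‖ = 1 →
      (∀ w ∈ fccSlots, ⟪F' κ w, m⟫_ℝ = 0 ∨ ⟪F' κ w, m⟫_ℝ = Real.sqrt (2 / 3) ∨ ⟪F' κ w, m⟫_ℝ = -Real.sqrt (2 / 3)) →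
      ⟪d' κ, m⟫_ℝ = Real.sqrt (2 / 3) → ∀ x, F' (next' κ m) x = F' κ x - (2 * ⟪F' κ x, m⟫_ℝ) • m := by
    intro κ m hm hmenu hdm x
    obtain ⟨h1, hfr, -, -⟩ := hspec κ m hm hmenu hdm
    show F (next' κ m).1 x = F κ.1 x - (2 * ⟪F κ.1 x, m⟫_ℝ) • m; rw [h1]; exact hfr x
  have hinv : ∀ (κ : {κ : List (EuclideanSpace ℝ (Fin 3)) // WF κ}) (m : EuclideanSpace ℝ (Fin 3)), ‖m‖ = 1 →
      (∀ w ∈ fccSlots, ⟪F' κ w, m⟫_ℝ = 0 ∨ ⟪F' κ w, m⟫_ℝ = Real.sqrt (2 / 3) ∨ ⟪F' κ w, m⟫_ℝ = -Real.sqrt (2 / 3)) →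
      ⟪d' κ, m⟫_ℝ = Real.sqrt (2 / 3) → next' (next' κ m) m = κ := by
    intro κ m hm hmenu hdm
    obtain ⟨h1, -, -, hback⟩ := hspec κ m hm hmenu hdm
    apply Subtype.ext
    have h2 : (next' (next' κ m) m).1 = next (next' κ m).1 m := by
      simp only [hnext']; rw [dif_pos]; rw [h1, hback]; exact κ.2
    rw [h2, h1, hback]
  have hdnext : ∀ (κ : {κ : List (EuclideanSpace ℝ (Fin 3)) // WF κ}) (m : EuclideanSpace ℝ (Fin 3)), ‖m‖ = 1 →
      (∀ w ∈ fccSlots, ⟪F' κ w, m⟫_ℝ = 0 ∨ ⟪F' κ w, m⟫_ℝ = Real.sqrt (2 / 3) ∨ ⟪F' κ w, m⟫_ℝ = -Real.sqrt (2 / 3)) →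
      ⟪d' κ, m⟫_ℝ = Real.sqrt (2 / 3) → ⟪d' (next' κ m), m⟫_ℝ = Real.sqrt (2 / 3) := by
    intro κ m hm hmenu hdm
    obtain ⟨h1, -, hdir, -⟩ := hspec κ m hm hmenu hdm
    show ⟪F (next' κ m).1 (u (next' κ m).1), m⟫_ℝ = Real.sqrt (2 / 3); rw [h1]; exact hdir
  have hd : ∀ κ : {κ : List (EuclideanSpace ℝ (Fin 3)) // WF κ}, ∃ u' ∈ fccSlots, d' κ = F' κ u' :=
    fun κ => ⟨u κ.1, hu κ.1, rfl⟩
  have hdn : ∀ κ : {κ : List (EuclideanSpace ℝ (Fin 3)) // WF κ}, ∃ m : EuclideanSpace ℝ (Fin 3), ‖m‖ = 1 ∧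
      (∀ w ∈ fccSlots, ⟪F' κ w, m⟫_ℝ = 0 ∨ ⟪F' κ w, m⟫_ℝ = Real.sqrt (2 / 3) ∨ ⟪F' κ w, m⟫_ℝ = -Real.sqrt (2 / 3)) ∧
      ⟪d' κ, m⟫_ℝ = Real.sqrt (2 / 3) := fun κ => exists_menuNormal_far (F κ.1) (hu κ.1)
  -- rigidity: the slot dozen determines the word; the direction determines the word
  have hinjK : ∀ κ κ' : {κ : List (EuclideanSpace ℝ (Fin 3)) // WF κ},
      (F' κ : EuclideanSpace ℝ (Fin 3) → EuclideanSpace ℝ (Fin 3)) '' ↑fccSlots =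
      (F' κ' : EuclideanSpace ℝ (Fin 3) → EuclideanSpace ℝ (Fin 3)) '' ↑fccSlots → κ = κ' :=
    fun κ κ' himg => Subtype.ext (word_eq_of_image_eq hFc huc hWFc κ.2 κ'.2 himg)
  have hdinj : ∀ κ κ' : {κ : List (EuclideanSpace ℝ (Fin 3)) // WF κ}, d' κ = d' κ' → κ = κ' :=
    fun κ κ' hdd => Subtype.ext (word_dir_injective hFc huc hWFc (hu []) κ.2 κ'.2 hdd)
  -- the certified states and the move map
  obtain ⟨W, hW, hmult⟩ := exists_certified_states (F := F') (d := d') hX hinjK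
  obtain ⟨f, hf_full, hf_cross, hf_glide, hf_narrow⟩ := exists_word_move_map_gen X F' d' next' hd
  have htarget : ∀ v ∈ W, IsMoving X ver (F' v.2) (d' v.2) v.1 →
      f v ∈ W ∧ (f v).1 - d' (f v).2 = v.1 ∧ dist v.1 (f v).1 = 1 :=
    fun v hv hm => word_move_target_gen ver hd hdn hmirror hdnext hW (fun v _ => hf_full v)
      (fun v _ m => hf_cross v m) (fun v _ m => hf_glide v m) (fun v _ _ hn => hf_narrow v hn) hv hm
  have hinjW : Set.InjOn f {v | v ∈ W ∧ IsMoving X ver (F' v.2) (d' v.2) v.1} :=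
    word_move_injOn_gen ver hX hd hmirror hinv hdnext (fun v hv => ((hW v).1 hv).2.2) (fun v _ => hf_full v)
      (fun v _ m => hf_cross v m) (fun v _ m => hf_glide v m) (fun v _ _ hn => hf_narrow v hn)
  -- the invariant, lifted to the subtype of well-formed words, along moves
  set Pw : EuclideanSpace ℝ (Fin 3) × {κ : List (EuclideanSpace ℝ (Fin 3)) // WF κ} → Prop :=
    fun v => P (v.1, v.2.1) with hPwdef
  have hsrc : ∀ p ∈ L, (p, root) ∈ W ∧ IsMoving X ver (F' (p, root).2) (d' (p, root).2) (p, root).1 ∧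
      f (p, root) = (p + d' root, root) ∧ Pw (p + d' root, root) := by
    intro p hp
    obtain ⟨hpX, htri, hpred, hmv, hP⟩ := hLsrc p hp
    have hW' : (p, root) ∈ W := (hW _).2 ⟨hpX, htri, hpred⟩
    rcases hmv with hfull | ⟨m, htd, h0⟩ | ⟨hver, hnar⟩
    · exact ⟨hW', Or.inl hfull, hf_full (p, root) hfull, hP⟩
    · exact ⟨hW', Or.inr (Or.inl ⟨m, htd, Or.inr h0⟩), hf_glide (p, root) m htd h0, hP⟩
    · exact ⟨hW', Or.inr (Or.inr ⟨hver, hnar⟩), hf_narrow (p, root) hnar, hP⟩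
  have hLstep' : ∀ p ∈ L, p + d' root ∉ L := fun p hp => hLstep p hp
  have hPmov : ∀ v ∈ W, IsMoving X ver (F' v.2) (d' v.2) v.1 → Pw v → Pw (f v) := by
    intro v _ hm hv
    rcases hm with hfull | ⟨m, htd, hdm⟩ | ⟨hver, hnar⟩
    · rw [hf_full v hfull]; exact hPstraight v.1 v.2.1 v.2.2 (Or.inl hfull) hv
    · rcases hdm with hdm | hdm
      · rw [hf_cross v m htd hdm]
        obtain ⟨h1, -, -, -⟩ := hspec v.2 m htd.1.1 htd.1.2 hdm
        have hwf : WF (next v.2.1 m) := by rw [← h1]; exact (next' v.2 m).2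
        show P ((v.1 + F (next' v.2 m).1 (u (next' v.2 m).1), (next' v.2 m).1))
        rw [h1]
        exact hPcross v.1 v.2.1 m v.2.2 hwf htd hdm hv
      · rw [hf_glide v m htd hdm]; exact hPstraight v.1 v.2.1 v.2.2 (Or.inr (Or.inl ⟨m, htd, hdm⟩)) hv
    · rw [hf_narrow v hnar]; exact hPstraight v.1 v.2.1 v.2.2 (Or.inr (Or.inr ⟨hver, hnar⟩)) hv
  -- no re-entry from the window: a class reading a face at a core ball moves like the root, hence came from below
  have hnoReentry : ∀ v ∈ W, IsMoving X ver (F' v.2) (d' v.2) v.1 → Pw v → -R₀ - 1 ≤ v.1 2 → v.1 2 < h + R₀ + 1 →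
      (f v).1 ∉ P' := by
    intro v hvW hm _ hlo _ hP'
    obtain ⟨hfW, hback, -⟩ := htarget v hvW hm
    obtain ⟨-, htri, -⟩ := (hW (f v)).1 hfW
    have hdir : d' (f v).2 = d' root := hstd (f v).2.1 (f v).2.2 (f v).1 hP' htri
    have hv1 : v.1 = (f v).1 - d' root := by rw [← hdir, hback]
    have h2 : v.1 2 = (f v).1 2 - (F [] (u [])) 2 := by rw [hv1]; rfl
    linarith [hP'top _ hP']
  -- top sealing + exclusion: a window state cannot step into the sealing band of the top plate
  have hsealT : ∀ v ∈ W, IsMoving X ver (F' v.2) (d' v.2) v.1 → Pw v → -R₀ - 1 ≤ v.1 2 → v.1 2 < h + R₀ + 1 →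
      h + R₀ + 1 ≤ (f v).1 2 → (f v).1 2 ≤ h + R₀ + 1 + 1 → (f v).1 0 ^ 2 + (f v).1 1 ^ 2 ≤ (ρ - 2) ^ 2 → False := by
    intro v hvW hm hPv _ _ hge hle hlat
    obtain ⟨hfW, -, -⟩ := htarget v hvW hm
    obtain ⟨hfX, htri, -⟩ := (hW (f v)).1 hfW
    exact hPexcl0 (f v).1 (f v).2.1 (f v).2.2 (hPmov v hvW hm hPv) (hP₂seal _ hfX hge hle hlat) htri
  -- the abstract exact count from the launch set, plates abstracted
  have key := word_sources_le_exact_launch_cell (fun v => IsMoving X ver (F' v.2) (d' v.2) v.1) L (root := root)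
    (P := Pw) hW hmult htarget hinjW hsrc hLstep' hPmov hnoReentry hR₀ hρ hP'top hsealB hsealT
  -- the end set and the relaunch set of the abstract count, in membership form
  obtain ⟨E, RL, hkey, hEmem, hRLmem⟩ :
      ∃ (E : Finset (EuclideanSpace ℝ (Fin 3) × {κ : List (EuclideanSpace ℝ (Fin 3)) // WF κ}))
        (RL : Finset (EuclideanSpace ℝ (Fin 3))),
      (L.filter fun p => -R₀ - 1 < (p + F [] (u [])) 2 ∧ (p + F [] (u [])) 2 < h + R₀ + 1).card ≤
        E.card + RL.card +
        220 * (X.filter fun s => h + R₀ + 1 ≤ s 2 ∧ s 2 ≤ h + R₀ + 1 + 1 ∧ (ρ - 2) ^ 2 < s 0 ^ 2 + s 1 ^ 2).card +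
        220 * (X.filter fun s => -R₀ - 1 - 1 ≤ s 2 ∧ s 2 < -R₀ - 1 ∧ (ρ - 1) ^ 2 < s 0 ^ 2 + s 1 ^ 2).card ∧
      (∀ v, v ∈ E ↔ v ∈ W ∧ (-R₀ - 1 ≤ v.1 2 ∧ v.1 2 < h + R₀ + 1 ∧ ¬ IsMoving X ver (F' v.2) (d' v.2) v.1 ∧
        Pw v ∧ ∃ u ∈ W, IsMoving X ver (F' u.2) (d' u.2) u.1 ∧ f u = v)) ∧
      (∀ p, p ∈ RL ↔ p ∈ L ∧ ∃ v ∈ W, IsMoving X ver (F' v.2) (d' v.2) v.1 ∧ Pw v ∧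
        -R₀ - 1 ≤ v.1 2 ∧ v.1 2 < h + R₀ + 1 ∧ f v = (p, root)) :=
    ⟨_, _, key, fun v => by simp only [Finset.mem_filter], fun p => by simp only [Finset.mem_filter]⟩
  -- the RELAUNCH set in geometric form
  have hrel : RL.card ≤
      (L.filter fun p => P (p - F [] (u []), []) ∧
            -R₀ - 1 ≤ (p - F [] (u [])) 2 ∧ (p - F [] (u [])) 2 < h + R₀ + 1 ∧
            (IsFull X (F []) (p - F [] (u [])) ∨
              (∃ m, IsTwinReading X (F []) m (p - F [] (u [])) ∧ ⟪F [] (u []), m⟫_ℝ = 0) ∨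
              (ver = WordVersion.v2 ∧ IsNarrow X (F []) (F [] (u [])) (p - F [] (u [])))) ∨
          ∃ μ, WF [μ] ∧ P (p - F [] (u []), [μ]) ∧
            -R₀ - 1 ≤ (p - F [] (u [])) 2 ∧ (p - F [] (u [])) 2 < h + R₀ + 1 ∧
            ∃ m, IsTwinReading X (F [μ]) m (p - F [] (u [])) ∧
              ⟪F [μ] (u [μ]), m⟫_ℝ = Real.sqrt (2 / 3) ∧ next [μ] m = []).card := by
    refine card_le_card fun p hp => ?_
    rw [mem_filter]
    obtain ⟨hpL, v, hvW, hm, hPv, hlo, hhi, hfv⟩ := (hRLmem p).1 hp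
    refine ⟨hpL, ?_⟩
    obtain ⟨-, hback, -⟩ := htarget v hvW hm
    rw [hfv] at hback
    -- the arriving state sits at the root-line predecessor
    have hv1 : v.1 = p - F [] (u []) := by rw [← hback]
    have hlo' : -R₀ - 1 ≤ (p - F [] (u [])) 2 := by rw [← hv1]; exact hlo
    have hhi' : (p - F [] (u [])) 2 < h + R₀ + 1 := by rw [← hv1]; exact hhi
    have hPv' : P (v.1, v.2.1) := hPv
    rcases hm with hfull | ⟨m, htd, hdm⟩ | ⟨hver, hnar⟩
    · -- straight from a full shell: the class is the root class
      have hf := hf_full v hfull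
      rw [hf] at hfv
      have hv2 : v.2 = root := (Prod.mk.inj hfv).2
      have hfull' : IsFull X (F v.2.1) v.1 := hfull
      rw [hv1, hv2] at hfull' hPv'
      exact Or.inl ⟨hPv', hlo', hhi', Or.inl hfull'⟩
    · rcases hdm with hcr | hgl
      · -- a cross popping to the root class: the class is a one-letter class `[μ]`
        have hf := hf_cross v m htd hcr
        rw [hf] at hfv
        have hnx : next' v.2 m = root := (Prod.mk.inj hfv).2
        obtain ⟨h1, -, -, -⟩ := hspec v.2 m htd.1.1 htd.1.2 hcr
        have hnil : next v.2.1 m = [] := by rw [← h1]; exact congrArg Subtype.val hnx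
        -- `next κ m = []` forces a pop: the class is `[μ]`
        obtain ⟨μ, hμ⟩ : ∃ μ, v.2.1 = [μ] := by
          by_cases hpush : ∀ μ κ', v.2.1 = μ :: κ' → (F v.2.1).symm m ≠ -μ
          · have := hnext_push v.2.1 m hpush
            rw [hnil] at this; exact absurd this.symm (List.cons_ne_nil _ _)
          · push Not at hpush
            obtain ⟨μ, κ', hκe, hsymm⟩ := hpush
            have hpop := hnext_pop μ κ' m (by rw [← hκe]; exact hsymm)
            rw [← hκe, hnil] at hpop; exact ⟨μ, by rw [hκe, ← hpop]⟩
        have hwf : WF [μ] := by rw [← hμ]; exact v.2.2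
        have htd' : IsTwinReading X (F v.2.1) m v.1 := htd
        have hcr' : ⟪F v.2.1 (u v.2.1), m⟫_ℝ = Real.sqrt (2 / 3) := hcr
        rw [hv1, hμ] at htd' hPv'; rw [hμ] at hcr' hnil
        exact Or.inr ⟨μ, hwf, hPv', hlo', hhi', m, htd', hcr', hnil⟩
      · -- a glide: the class is the root class
        have hf := hf_glide v m htd hgl
        rw [hf] at hfv
        have hv2 : v.2 = root := (Prod.mk.inj hfv).2
        have htd' : IsTwinReading X (F v.2.1) m v.1 := htd
        have hgl' : ⟪F v.2.1 (u v.2.1), m⟫_ℝ = 0 := hgl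
        rw [hv1, hv2] at htd' hPv'; rw [hv2] at hgl'
        exact Or.inl ⟨hPv', hlo', hhi', Or.inr (Or.inl ⟨m, htd', hgl'⟩)⟩
    · -- narrow (version `v2`): the class is the root class
      have hf := hf_narrow v hnar
      rw [hf] at hfv
      have hv2 : v.2 = root := (Prod.mk.inj hfv).2
      have hnar' : IsNarrow X (F v.2.1) (F v.2.1 (u v.2.1)) v.1 := hnar
      rw [hv1, hv2] at hnar' hPv'
      exact Or.inl ⟨hPv', hlo', hhi', Or.inr (Or.inr ⟨hver, hnar'⟩)⟩
  -- the END PAIRS: (end ball, predecessor ball); distinct ends give distinct pairs by direction injectivity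
  set T : Finset (EuclideanSpace ℝ (Fin 3) × EuclideanSpace ℝ (Fin 3)) := E.image fun v => (v.1, v.1 - d' v.2) with hT
  have hTcard : T.card = E.card := by
    refine Finset.card_image_of_injOn ?_
    intro v₁ _ v₂ _ heq
    simp only [Prod.mk.injEq] at heq
    obtain ⟨h1, h2⟩ := heq
    have hdd : d' v₁.2 = d' v₂.2 := by have := h2; rw [h1] at this; exact sub_right_injective this
    exact Prod.ext h1 (hdinj _ _ hdd)
  refine ⟨T, ?_, ?_, ?_, ?_, ?_⟩
  · rw [hTcard]
    exact hkey.trans (Nat.add_le_add_right (Nat.add_le_add_right (Nat.add_le_add_left hrel _) _) _)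
  · -- balls, contact, window
    intro bq hbq
    obtain ⟨v, hv, rfl⟩ := mem_image.1 hbq
    obtain ⟨hvW, h1, h2, -, -, -⟩ := (hEmem v).1 hv
    obtain ⟨hbX, -, hpred⟩ := (hW v).1 hvW
    obtain ⟨u', hu', hdu⟩ := hd v.2
    refine ⟨hbX, hpred, ?_, h1, h2⟩
    show dist v.1 (v.1 - d' v.2) = 1
    rw [dist_eq_norm, sub_sub_cancel, hdu, LinearIsometryEquiv.norm_map, norm_eq_one_of_mem_fccSlots hu']
  · -- the two-payer dichotomy
    intro bq hbq
    obtain ⟨v, hv, rfl⟩ := mem_image.1 hbq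
    obtain ⟨hvW, -, -, hnm, -, -⟩ := (hEmem v).1 hv
    obtain ⟨hnf, hnt⟩ := not_full_not_twin_of_not_isMoving hnm
    exact certified_end_two_payers hg hc hX hd hW hvW hnf hnt
  · -- the invariant at the end ball
    intro bq hbq
    obtain ⟨v, hv, rfl⟩ := mem_image.1 hbq
    obtain ⟨-, -, -, -, hP, -⟩ := (hEmem v).1 hv
    exact ⟨v.2.1, v.2.2, hP⟩
  · -- the moving predecessor and the non-moving target: `IsEndMove`
    intro bq hbq
    obtain ⟨v, hv, rfl⟩ := mem_image.1 hbq
    obtain ⟨-, -, -, hnm, -, u', hu'W, hum, hfu⟩ := (hEmem v).1 hv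
    obtain ⟨-, hback, -⟩ := htarget u' hu'W hum
    rw [hfu] at hback
    obtain ⟨-, -, hpredu⟩ := (hW u').1 hu'W
    -- the pair is `((f u').1, u'.1)`
    have hpair : (v.1, v.1 - d' v.2) = ((f u').1, u'.1) := by rw [← hback, hfu]
    have hv1 : v.1 = (f u').1 := by rw [hfu]
    rw [hpair]; refine ⟨u'.2.1, u'.2.2, hpredu, ?_⟩
    -- the non-moving clause of the END state `v = f u'`
    have hnm' : ¬ IsMoving X ver (F v.2.1) (F v.2.1 (u v.2.1)) v.1 := hnm
    rcases hum with hfull | ⟨m, htd, hdm⟩ | ⟨hver, hnar⟩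
    · -- straight from a full shell
      have hf := hf_full u' hfull
      have hv2 : v.2 = u'.2 := by rw [← hfu, hf]
      have e1 : v.1 = u'.1 + d' u'.2 := by rw [hv1, hf]
      rw [hv2, e1] at hnm'
      exact Or.inl ⟨Or.inl hfull, by rw [hf], by rw [hf]; exact hnm'⟩
    · rcases hdm with hcr | hgl
      · -- cross along `m`
        have hf := hf_cross u' m htd hcr
        obtain ⟨h1, hfr, -, -⟩ := hspec u'.2 m htd.1.1 htd.1.2 hcr
        have hdir : F (next' u'.2 m).1 (u (next' u'.2 m).1) =
            -(F u'.2.1 (u u'.2.1) - (2 * ⟪F u'.2.1 (u u'.2.1), m⟫_ℝ) • m) := by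
          rw [h1, hfr, word_u_next huc hnext_pop hnext_push, map_neg, inner_neg_left]
          module
        have htarget' : u'.1 + F (next' u'.2 m).1 (u (next' u'.2 m).1) =
            u'.1 - (F u'.2.1 (u u'.2.1) - (2 * ⟪F u'.2.1 (u u'.2.1), m⟫_ℝ) • m) := by
          rw [hdir]; abel
        have hv2 : v.2 = next' u'.2 m := by rw [← hfu, hf]
        have e1 : v.1 = u'.1 + d' (next' u'.2 m) := by rw [hv1, hf]
        -- the new class's frame is the mirrored frame, its direction is `b − q`
        have hG : F (next' u'.2 m).1 = (F u'.2.1).trans (ℝ ∙ m)ᗮ.reflection :=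
          LinearIsometryEquiv.ext fun x => by
            rw [h1, hfr, LinearIsometryEquiv.trans_apply, reflection_unit_apply htd.1.1]
        have hbq : d' (next' u'.2 m) = (u'.1 + d' (next' u'.2 m)) - u'.1 := by abel
        refine Or.inr ⟨m, htd, hcr, by rw [hf]; exact htarget', ?_⟩
        rw [hf]
        dsimp only
        rw [hv2, e1] at hnm'
        have hnm'' : ¬ IsMoving X ver (F (next' u'.2 m).1) (d' (next' u'.2 m)) (u'.1 + d' (next' u'.2 m)) := hnm'
        rw [hG] at hnm''; rw [hbq] at hnm''
        simpa only [add_sub_cancel_left] using hnm''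
      · -- glide along `m`
        have hf := hf_glide u' m htd hgl
        have hv2 : v.2 = u'.2 := by rw [← hfu, hf]
        have e1 : v.1 = u'.1 + d' u'.2 := by rw [hv1, hf]
        rw [hv2, e1] at hnm'
        exact Or.inl ⟨Or.inr (Or.inr ⟨m, htd, hgl⟩), by rw [hf], by rw [hf]; exact hnm'⟩
    · -- narrow (version `v2`)
      have hf := hf_narrow u' hnar
      have hv2 : v.2 = u'.2 := by rw [← hfu, hf]
      have e1 : v.1 = u'.1 + d' u'.2 := by rw [hv1, hf]
      rw [hv2, e1] at hnm'
      exact Or.inl ⟨Or.inr (Or.inl ⟨hver, hnar⟩), by rw [hf], by rw [hf]; exact hnm'⟩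

end Instance

end Summit.Ventures.Crystal3D.Theorems

end
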